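import Summits.BirchSwinnertonDyer.Rank1Residual.X11a.PartnerSplitType
import Literature.NumberTheory.EllipticCurves.SemistableModPImageIrreducibleProofs
import HarnessLib

/-!
# Class X11a, route (3d): a good `p`-congruent partner of a multiplicative curve is ORDINARY
# (cell `b2b-bsdres`, unit `b2b-bsdres-x11a`, gen 25)

HONEST FRAMING (run/shared/lean/b2b/bsd-rank1-residual/, verbatim in every file): the goal of the
cell is to DELETE the COMBINATION-SHAPED residual classes of the Birch–Swinnerton-Dyer formula for
ALL analytic-rank `≤ 1` elliptic curves over `ℚ` — "full BSD formula for every rank `≤ 1` curve in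
class `C`" assembled STRICTLY from published theorems — so that the rank-`≤ 1` remainder becomes
exactly the CONSTRUCTION-SHAPED classes, which are TYPED (missing-input `Prop`s), NOT attempted.
This is not "finishing BSD". Research route; NO CLAIM BEYOND STATED CLASSES. Theorems only; no
definition, no new named fact; nothing booked; no label change.

WHAT. Route (3d) (`X11a/TrivialPartner.lean`, gen 24) transports Mazur's main conjecture with
`μ = 0` to a multiplicative X11a pair `(E, p)` from a `p`-congruent partner `A` which is GOOD
ORDINARY at `p`; the partner's ordinarity `hordA : p ∤ a_p(A)` was one of its finite certificates.
THIS FILE discharges it from the congruence: **for `p` odd, `E` multiplicative at `p`, `A` good at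
`p` and `A[p] ≃ E[p]` `Γ_ℚ`-equivariantly, `A` is ordinary at `p`**
(`not_dvd_frobeniusTrace_of_equiv_of_hasMultiplicativeReduction`). Serre 1972, §1.11 Prop. 12 c)
(at a good SUPERSINGULAR prime the image of the inertia group `I_𝔓` in `Aut(A[p])` is cyclic of
order `p² - 1` — tree theorem `isCyclic_and_card_inertia_map_of_dvd_frobeniusTrace`) against §1.12
Cor. of Prop. 13 (at a MULTIPLICATIVE prime `I_𝔓` moves `E[p]` inside a subgroup `X` of order
`≤ p` — tree theorem `exists_addSubgroup_card_le_of_hasMultiplicativeReductionAt`): transported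
along `e`, both hold on `A[p]`, and §1 shows they are incompatible by counting — an inertia image
of order prime to `p` that is unipotent modulo a line `X = ℤ P₀` injects into `X` by `h ↦ h P₀`
(an element fixing `P₀` fixes `X`, is unipotent, has order dividing `p`, hence is trivial), so it
has at most `p < p² - 1` elements. Every input is a tree THEOREM (no named fact enters §1–§3).
The route-(3d)/(3a) theorems with `hordA` removed (tool, `BSD(E,p)`, the NON-SPLIT booking shape, the
CM-partner route) are re-issued in the companion file `X11a/PartnerOrdinaryRoutes.lean`. Nothing
booked; the class label is unchanged.

References: [Serre1972] §1.11 Prop. 12, §1.12 Cor. of Prop. 13; HOME/b2b-bsdres-x11a/REPORT-g25.md.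
-/

noncomputable section

open scoped Classical NumberField Pointwise

open NumberField IsDedekindDomain Field WeierstrassCurve
  Literature.NumberTheory.EllipticCurves Literature.NumberTheory.GaloisRepresentations
  Literature.NumberTheory.EllipticCurves.Rank1Residual
  Rat.HeightOneSpectrum

set_option autoImplicit false

namespace Summit.BirchSwinnertonDyer.Rank1Residual.X11a.PartnerOrdinary

variable {W A : WeierstrassCurve ℚ} [W.IsElliptic] [W.IsGloballyMinimal] [A.IsElliptic]
  [A.IsGloballyMinimal] {p : ℕ} [hp : Fact p.Prime]

/-! ## §1. An inertia image of order prime to `p`, unipotent modulo a small subgroup, is small -/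

omit [W.IsGloballyMinimal] in
/-- **Counting lemma.** Let `I ≤ Γ_ℚ` and `X ≤ E[p]` with `#X ≤ p` be such that every `τ ∈ I`
moves `E[p]` inside `X` (`τ P - P ∈ X`), and suppose `#ρ̄_{E,p}(I)` is prime to `p`. Then
`#ρ̄_{E,p}(I) ≤ p`: if `X = 0` the image is trivial; otherwise `X = ℤ P₀` is a line, `h ↦ h P₀`
maps the image into `X`, and injectively — an element of `I` fixing `P₀` fixes `X` pointwise, so it
is unipotent (`galoisRepTorsion_pow_prime_eq_one_of_unipotent`: its image has order dividing `p`)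
and its image, of order prime to `p`, is trivial. [folklore] -/
theorem natCard_map_galoisRepTorsion_le_of_forall_sub_mem
    (I : Subgroup (absoluteGaloisGroup ℚ)) (X : AddSubgroup (geomTorsion W (p : ℤ)))
    (hX : Nat.card X ≤ p)
    (hI : ∀ τ ∈ I, ∀ P : geomTorsion W (p : ℤ), τ • P - P ∈ X)
    (hcop : Nat.Coprime p (Nat.card (I.map (galoisRepTorsion W (p : ℤ))))) :
    Nat.card (I.map (galoisRepTorsion W (p : ℤ))) ≤ p := by
  have hpp := hp.out
  have hcardE : Nat.card (geomTorsion W (p : ℤ)) = p ^ 2 := Rank1Residual.natCard_geomTorsion W p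
  haveI : Finite (geomTorsion W (p : ℤ)) :=
    Nat.finite_of_card_ne_zero (by rw [hcardE]; exact pow_ne_zero _ hpp.ne_zero)
  -- an element of `I` fixing `X` pointwise has trivial image
  have hker : ∀ τ ∈ I, (∀ x ∈ X, τ • x = x) → galoisRepTorsion W (p : ℤ) τ = 1 := by
    intro τ hτ hfix
    have hunip : ∀ Q : geomTorsion W (p : ℤ), τ • (τ • Q - Q) = τ • Q - Q :=
      fun Q ↦ hfix _ (hI τ hτ Q)
    have hpow := galoisRepTorsion_pow_prime_eq_one_of_unipotent W p hunip
    have h1 : orderOf (galoisRepTorsion W (p : ℤ) τ) ∣ p := orderOf_dvd_of_pow_eq_one hpow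
    have h2 : orderOf (galoisRepTorsion W (p : ℤ) τ) ∣
        Nat.card (I.map (galoisRepTorsion W (p : ℤ))) :=
      Subgroup.orderOf_dvd_natCard _ (Subgroup.mem_map_of_mem _ hτ)
    exact orderOf_eq_one_iff.mp ((Nat.Coprime.coprime_dvd_left h1 hcop).eq_one_of_dvd h2)
  by_cases hbot : X = ⊥
  · -- `X = 0`: the image is trivial
    have htriv : I.map (galoisRepTorsion W (p : ℤ)) = ⊥ := by
      rw [Subgroup.eq_bot_iff_forall]
      rintro _ ⟨τ, hτ, rfl⟩
      exact hker τ hτ fun x hx ↦ by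
        rw [hbot, AddSubgroup.mem_bot] at hx
        rw [hx, smul_zero]
    rw [htriv, Subgroup.card_bot]
    exact hpp.one_le
  · -- `X = ℤ P₀` a line
    have htop : X ≠ ⊤ := by
      intro h
      rw [h, AddSubgroup.card_top, hcardE] at hX
      nlinarith [hpp.two_le]
    obtain ⟨P₀, hP₀X, -, hXeq⟩ := exists_eq_zmultiples_of_ne_bot_of_ne_top W p X hbot htop
    have hmemX : ∀ τ ∈ I, τ • P₀ ∈ X := fun τ hτ ↦ by
      have h := X.add_mem (hI τ hτ P₀) hP₀X
      rwa [sub_add_cancel] at h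
    have hfixX : ∀ τ : absoluteGaloisGroup ℚ, τ • P₀ = P₀ → ∀ x ∈ X, τ • x = x := by
      intro τ hτP x hx
      rw [hXeq, AddSubgroup.mem_zmultiples_iff] at hx
      obtain ⟨m, rfl⟩ := hx
      rw [smul_comm τ m P₀, hτP]
    haveI : Finite X := inferInstance
    -- evaluation at `P₀`
    let f : I.map (galoisRepTorsion W (p : ℤ)) → X := fun h ↦
      ⟨(h.1).toAdd P₀, by
        obtain ⟨τ, hτ, hτeq⟩ := Subgroup.mem_map.mp h.2
        rw [← hτeq, galoisRepTorsion_apply]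
        exact hmemX τ hτ⟩
    have hf : Function.Injective f := by
      rintro ⟨h₁, hh₁⟩ ⟨h₂, hh₂⟩ heq
      obtain ⟨τ₁, hτ₁, rfl⟩ := Subgroup.mem_map.mp hh₁
      obtain ⟨τ₂, hτ₂, rfl⟩ := Subgroup.mem_map.mp hh₂
      have heq' : τ₁ • P₀ = τ₂ • P₀ := by
        have h := congrArg Subtype.val heq
        simpa only [f, galoisRepTorsion_apply] using h
      have hτ : τ₂⁻¹ * τ₁ ∈ I := I.mul_mem (I.inv_mem hτ₂) hτ₁
      have hfixP : (τ₂⁻¹ * τ₁) • P₀ = P₀ := by rw [mul_smul, heq', inv_smul_smul]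
      have h1 := hker _ hτ (hfixX _ hfixP)
      rw [map_mul, map_inv, inv_mul_eq_one] at h1
      exact Subtype.ext h1.symm
    calc Nat.card (I.map (galoisRepTorsion W (p : ℤ))) ≤ Nat.card X :=
          Nat.card_le_card_of_injective f hf
      _ ≤ p := hX

/-! ## §2. Serre §1.11 Prop. 12 c) at every prime above a good supersingular `p` -/

/-- **At a good SUPERSINGULAR odd prime `p` of the globally minimal `A/ℚ`, for every prime `𝔓 ∣ p`
of `\bar ℤ`, the image of `I_𝔓` in `Aut(A[p])` has exactly `p² - 1` elements** (Serre 1972, §1.11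
Prop. 12 c)): the tree theorem `isCyclic_and_card_inertia_map_of_dvd_frobeniusTrace` at the place's
prime (tame Kummer surjectivity from `exists_mem_inertia_smul_eq_mul_of_pow_eq`), moved to `𝔓` by
conjugation (`isCyclic_and_card_map_inertia_smul`). [cite: Serre1972, §1.11 Prop. 12 c); §1.3 Prop. 1–2] -/
theorem natCard_map_inertia_galoisRepTorsion_of_dvd_frobeniusTrace (hp2 : p ≠ 2)
    (hgoodA : A.HasGoodReductionAtPrime p) (hss : (p : ℤ) ∣ A.frobeniusTrace p)
    {v : HeightOneSpectrum (𝓞 ℚ)} (hv : (primesEquiv v : ℕ) = p)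
    {𝔓 : Ideal (absIntegers (𝓞 ℚ) ℚ)} (h𝔓 : 𝔓 ∈ v.primesAbove) :
    IsCyclic ((𝔓.inertia (absoluteGaloisGroup ℚ)).map (galoisRepTorsion A (p : ℤ))) ∧
      Nat.card ((𝔓.inertia (absoluteGaloisGroup ℚ)).map (galoisRepTorsion A (p : ℤ))) =
        p ^ 2 - 1 := by
  have hpp := hp.out
  have hΔ : ¬ (p : ℤ) ∣ minimalDiscriminantInt A :=
    A.not_dvd_minimalDiscriminantInt_of_hasGoodReductionAtPrime' p hgoodA
  obtain ⟨𝔓₀, hmem, h𝔓₀⟩ := exists_ideal_placeOver p hv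
  obtain ⟨g, hg⟩ :=
    HeightOneSpectrum.exists_smul_eq_of_mem_primesAbove_holds (K := ℚ) (v := v) h𝔓₀ h𝔓
  rw [← hg]
  have hm : 0 < p ^ 2 - 1 := by
    have : 4 ≤ p ^ 2 := by nlinarith [hpp.two_le]
    omega
  exact isCyclic_and_card_map_inertia_smul (galoisRepTorsion A (p : ℤ)) g 𝔓₀
    (isCyclic_and_card_inertia_map_of_dvd_frobeniusTrace p hΔ hss hp2 hmem
      (fun π ζ hπ hζ ↦ exists_mem_inertia_smul_eq_mul_of_pow_eq p hm hv h𝔓₀ hπ hζ))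

/-! ## §3. A good congruent partner of a multiplicative curve is ordinary -/

omit [W.IsGloballyMinimal] in
/-- **`E` multiplicative at the odd prime `p`, `A` good at `p`, `A[p] ≃ E[p]` `Γ_ℚ`-equivariantly
⟹ `A` is ORDINARY at `p`** (`p ∤ a_p(A)`), for every `E[p]` (reducible or not). If `A` were
supersingular, `#ρ̄_{A,p}(I_𝔓) = p² - 1` (§2), prime to `p`; but `I_𝔓` moves `E[p]`, hence `A[p]`
(transport along `e`), inside a subgroup of order `≤ p` (Serre §1.12, tree theorem
`exists_addSubgroup_card_le_of_hasMultiplicativeReductionAt`), so `#ρ̄_{A,p}(I_𝔓) ≤ p` (§1) —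
and `p² - 1 > p`. All inputs are tree theorems. [cite: Serre1972, §1.11 Prop. 12 c), §1.12 Cor. of Prop. 13] -/
theorem not_dvd_frobeniusTrace_of_equiv_of_hasMultiplicativeReduction (hp2 : p ≠ 2)
    (hmult : W.HasMultiplicativeReductionAtPrime p) (hgoodA : A.HasGoodReductionAtPrime p)
    (e : geomTorsion A (p : ℤ) ≃+ geomTorsion W (p : ℤ))
    (he : ∀ (σ : absoluteGaloisGroup ℚ) (P : geomTorsion A (p : ℤ)), e (σ • P) = σ • e P) :
    ¬ (p : ℤ) ∣ A.frobeniusTrace p := by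
  intro hss
  have hpp := hp.out
  set v : HeightOneSpectrum (𝓞 ℚ) := (Rat.HeightOneSpectrum.primesEquiv).symm ⟨p, hpp⟩ with hvdef
  have hv : (Rat.HeightOneSpectrum.primesEquiv v : ℕ) = p := by
    rw [hvdef, Equiv.apply_symm_apply]
  obtain ⟨𝔓, -, h𝔓⟩ := exists_ideal_placeOver p hv
  set I := 𝔓.inertia (absoluteGaloisGroup ℚ) with hI
  -- supersingular: `#ρ̄_{A,p}(I_𝔓) = p² - 1`
  obtain ⟨-, hcardI⟩ :=
    natCard_map_inertia_galoisRepTorsion_of_dvd_frobeniusTrace hp2 hgoodA hss hv h𝔓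
  -- multiplicative: `I_𝔓` moves `E[p]` inside `X`, `#X ≤ p`
  have hpv : ((p : ℕ) : 𝓞 ℚ) ∈ v.asIdeal := natCast_mem_asIdeal_of_primesEquiv_eq hv
  have hmult' : W.HasMultiplicativeReductionAt v :=
    (hasMultiplicativeReductionAtPrime_primesEquiv_iff_holds W v p hv).mp hmult
  obtain ⟨X, hXcard, hX⟩ :=
    W.exists_addSubgroup_card_le_of_hasMultiplicativeReductionAt hp2 hpv hmult' h𝔓
  -- transport to `A[p]` along `e`
  set XA : AddSubgroup (geomTorsion A (p : ℤ)) := X.map e.symm.toAddMonoidHom with hXA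
  have hXAcard : Nat.card XA ≤ p := by
    rw [hXA, AddSubgroup.card_map_of_injective e.symm.injective]; exact hXcard
  have hmemXA : ∀ Q : geomTorsion A (p : ℤ), Q ∈ XA ↔ e Q ∈ X := fun Q ↦ by
    rw [hXA, AddSubgroup.mem_map_equiv, AddEquiv.symm_symm]
  have hIA : ∀ τ ∈ I, ∀ P : geomTorsion A (p : ℤ), τ • P - P ∈ XA := by
    intro τ hτ P
    rw [hmemXA, map_sub, he]
    exact hX τ hτ (e P)
  -- `p` is prime to `p² - 1`
  have hcop : Nat.Coprime p (Nat.card (I.map (galoisRepTorsion A (p : ℤ)))) := by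
    rw [hcardI]
    have h1 : Nat.Coprime (1 + (p ^ 2 - 1)) (p ^ 2 - 1) :=
      Nat.coprime_add_self_left.mpr (Nat.coprime_one_left _)
    have h2 : 1 + (p ^ 2 - 1) = p ^ 2 := by
      have : 1 ≤ p ^ 2 := Nat.one_le_pow _ _ hpp.pos
      omega
    rw [h2] at h1
    exact Nat.Coprime.coprime_dvd_left (dvd_pow_self p two_ne_zero) h1
  have hle := natCard_map_galoisRepTorsion_le_of_forall_sub_mem I XA hXAcard hIA hcop
  rw [hcardI] at hle
  have h1 : p ^ 2 ≤ p + 1 := by omega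
  nlinarith [hpp.two_le]

omit [W.IsGloballyMinimal] in
/-- The same in C1 shape (`∃ e`, as in `X11a.bsdp_of_trivialPartner`). [cite: Serre1972, §1.11 Prop. 12 c), §1.12 Cor. of Prop. 13] -/
theorem not_dvd_frobeniusTrace_of_torsionIso_of_hasMultiplicativeReduction (hp2 : p ≠ 2)
    (hmult : W.HasMultiplicativeReductionAtPrime p) (hgoodA : A.HasGoodReductionAtPrime p)
    (hC1 : ∃ e : geomTorsion A (p : ℤ) ≃+ geomTorsion W (p : ℤ),
      ∀ (σ : absoluteGaloisGroup ℚ) (P : geomTorsion A (p : ℤ)), e (σ • P) = σ • e P) :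
    ¬ (p : ℤ) ∣ A.frobeniusTrace p := by
  obtain ⟨e, he⟩ := hC1
  exact not_dvd_frobeniusTrace_of_equiv_of_hasMultiplicativeReduction hp2 hmult hgoodA e he

omit [W.IsGloballyMinimal] in
/-- **SPLIT `E`, ANY good `p`-congruent partner `A` (ordinary or not a priori): `p ∣ a_p(A) - 1`.**
Gen 24's `dvd_frobeniusTrace_sub_one_of_equiv_of_split` with its ordinarity hypothesis discharged
by §3. Granted A40 (`hT`). [cite: Serre1972, §1.11 (1), Prop. 11, Prop. 12 c), §1.12]
[cite: SilvermanATAEC1994, Ch. V Thm. 3.1 and Thm. 5.3] -/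
theorem dvd_frobeniusTrace_sub_one_of_equiv_of_split_of_good
    (hT : Silverman1994_thmV53_tateUniformisation.{0}) (hp2 : p ≠ 2)
    (hsplit : W.HasSplitMultiplicativeReductionAtPrime p) (hgoodA : A.HasGoodReductionAtPrime p)
    (e : geomTorsion A (p : ℤ) ≃+ geomTorsion W (p : ℤ))
    (he : ∀ (σ : absoluteGaloisGroup ℚ) (P : geomTorsion A (p : ℤ)), e (σ • P) = σ • e P) :
    (p : ℤ) ∣ A.frobeniusTrace p - 1 :=
  PartnerSplitType.dvd_frobeniusTrace_sub_one_of_equiv_of_split hT hp2 hsplit hgoodA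
    (not_dvd_frobeniusTrace_of_equiv_of_hasMultiplicativeReduction hp2
      hsplit.hasMultiplicativeReductionAtPrime hgoodA e he) e he

end Summit.BirchSwinnertonDyer.Rank1Residual.X11a.PartnerOrdinary

end
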